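import Literature.Analysis.FluidPDE.LocalHelmholtzSupBound
import Literature.Analysis.FluidPDE.SingularKernelHolder
import Literature.Analysis.FluidPDE.SingularKernelTruncation
import Literature.Analysis.FluidPDE.TaoClassSliceData
import HarnessLib

/-!
# The Biot–Savart representation `v = K₃ ∗ curl v` for square-integrable fields
# (no `curl v ∈ L¹`, no decay hypothesis), and: every Tao-class slice is the Biot–Savart velocity
# of its vorticity

Analysis/FluidPDE proof file (theorems only; no definitions, no named facts). The tree's
Biot–Savart representation theorem `biotSavart_curl_eq_self_holds` (`BiotSavartRepresentation.lean`,
Majda–Bertozzi Prop. 2.16) asks the vorticity to be INTEGRABLE and bounded and the velocity to tend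
to `0` at infinity. For the smooth finite-energy (`H^∞`) velocity fields of Tao's class this is one
hypothesis too many: a slice `u(t)` has `u(t), curl u(t) ∈ L²(ℝ³)` (all Sobolev norms are finite)
but `curl u(t) ∈ L¹(ℝ³)` is NOT part of the class — e.g. for axisymmetric swirl-free data with
`ω_θ/r ∈ L¹` only (Gallay–Šverák's class `ω₀ ∈ L¹(Ω)`), which is why
`IsTaoSolutionOn.biotSavart_curl_eq` (`AxisymNoSwirlScaleInvariantBounds.lean`) carries the extra
hypothesis `Integrable (curl (u t))` and why the reduction of Gallay–Šverák's (1.12) to (1.11) was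
left open there (module docstring of `AxisymBiotSavartSupBound.lean`, "What is NOT here"). This file
removes the hypothesis:

* `eq_biotSavart_curl_suppCutoff_smul_add` — the tree's **local Helmholtz identity at a point**
  `eq_biotSavart_curl_smul_add` (cutoff at scale `1`) re-run at an arbitrary scale `ρ > 0`: for
  `v ∈ C²` divergence free and `φ_ρ = suppCutoff x ρ` (`= 1` on `B̄(x, ρ)`, `= 0` off `B(x, 2ρ)`),
  `v(x) = (K₃ ∗ curl(φ_ρ v))(x) + ∑ⱼ (∫ ∂ⱼΓ(x − y) ⟪v(y), ∇φ_ρ(y)⟫ dy) eⱼ`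
  (Majda–Bertozzi §2.4.1, (2.92)–(2.95), read off at the centre of the cutoff; same proof);
* `biotSavart_curl_eq_self_of_lintegral_sq_lt_top` — **`K₃ ∗ curl v = v` for every `C²`
  divergence-free `v` with `∫‖v‖² < ∞` and `∫‖curl v‖² < ∞`.** Proof: let `ρ → ∞` in the identity.
  With `ω = curl v`, `curl(φ_ρ v) = φ_ρ ω + Dφ_ρ ⊗ v` (`curl_smul`); since `‖Dφ_ρ‖ ≤ B/ρ` lives on the
  shell `ρ ≤ |y − x| ≤ 2ρ` where `|x − y|⁻² ≤ ρ⁻²`, both the cutoff part of the Biot–Savart integral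
  and the pressure-like sum are bounded by `(4π)⁻¹ B ρ⁻³ ∫_{B̄(x,2ρ)} ‖v‖ ≤ A (1 + ∫‖v‖²) ρ⁻¹`
  (`ab ≤ (εa² + ε⁻¹b²)/2` with `ε = ρ⁻¹` and `|B̄(x, 2ρ)| = 8ρ³|B̄₁|`, `Measure.addHaar_closedBall` — no
  Hölder inequality is needed), while `(K₃ ∗ (φ_ρ ω))(x) → (K₃ ∗ ω)(x)` by dominated convergence:
  the integrand is eventually constant in `ρ` at every `y`, and is dominated by
  `(4π)⁻¹ ‖ω(y)‖ |x − y|⁻²`, which is integrable near `x` (`ω` is continuous, `|z|⁻² ∈ L¹_loc`,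
  `kernelMajorant`) and away from `x` (`≤ ((4π)⁻¹/2)(‖ω(y)‖² + |x − y|⁻⁴)`, `memLp_two_farKernel`).
  Neither `ω ∈ L¹` nor any decay of `v` or `ω` at infinity is used — `v ∈ L²` alone kills the shell
  terms. (Majda–Bertozzi prove Prop. 2.16 for smooth rapidly decaying `ω`; the statement here is the
  `L²` form their Hodge-decomposition argument gives.)
* `IsTaoSolutionOn.biotSavart_curl_eq_self` — **every slice of a Tao-class solution is the
  Biot–Savart velocity of its vorticity**, `biotSavart (curl (u t)) = u t` for `t ∈ [0, T]`
  (`u(t) ∈ C^∞`, `div u(t) = 0`, `∫‖u(t)‖² < ∞` and `∫‖Du(t)‖² < ∞` from the `H⁰`/`H¹` bounds of the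
  class, `‖curl w‖ ≤ ‖curlCLM‖ ‖Dw‖`). This is the identification "the velocity field `u` can be
  reconstructed from `ω_θ` by the axisymmetric Biot–Savart law" (Gallay–Šverák 2015, p. 3, (1.3) and
  (2.8)) for the tree's smooth class WITHOUT the integrability proviso of
  `IsTaoSolutionOn.biotSavart_curl_eq`, i.e. the representation step of the reduction
  (1.12) ⇐ (1.11) (`GallaySverak2015.VelocitySupDecay` ⇐ `GallaySverak2015.VorticitySupBound`, via the
  PROVED sup-norm form (2.10) `norm_biotSavart_le_sqrt_of_isAxisymmetric_of_norm_le` and Lemma 5.1).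

## Mathlib / tree search

Tree (used): `eq_biotSavart_curl_smul_add` and its tools `curl_curl_eq_sum_fderiv_divergence_sub_laplacian`,
`integral_newtonKernel_smul_laplacian`, `integrable_biotSavartKernel_sub_apply_of_hasCompactSupport`,
`memLp_two_farKernel` (`LocalHelmholtzSupBound`); `suppCutoff`, `contDiff_suppCutoff`,
`suppCutoff_eq_one/zero`, `hasCompactSupport_suppCutoff`, `fderiv_suppCutoff_eq_zero`
(`SingularKernelGradient`), `norm_fderiv_suppCutoff_le`, `fderiv_suppCutoff_eq_zero_of_lt`
(`SingularKernelHolder`), `exists_norm_fderiv_radialCutoff_le` (`SingularKernelTruncation`);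
`biotSavart_eq_neg_integral_newtonKernel_smul_curl`, `integral_newtonKernel_smul_fderiv_eq`,
`norm_fderiv_newtonKernel_le` (`BiotSavartNewtonKernel`); `curl_smul`, `norm_curl_le`, `curlCLM`
(`VorticityCalculus`, `TaoEnstrophyLocalisation`); `norm_biotSavartKernel_le`, `kernelMajorant`,
`integrable_kernelMajorant` (`BiotSavartBounds`); `measurable_biotSavartKernel_sub_apply`
(`BiotSavartIntegral`); `IsTaoSolutionOn.integrable_norm_sq`, `…integrable_norm_fderiv_sq`
(`TaoClassSliceData`). `lean search 'biotSavart \(curl .*\) .* = |biotSavart_curl_eq'` (2026-08-27):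
the only representation theorems are `biotSavart_curl_eq_self_holds` (`ω ∈ L¹ ∩ L^∞`, `u → 0`),
`HolderEulerBiotSavart` (compactly supported curl) and the torus identity `BDSV.eq_biotSavart_curl_add`
— no `L²` form before this file. Mathlib: `tendsto_integral_of_dominated_convergence`,
`Measure.addHaar_closedBall`, `finrank_euclideanSpace_fin`, `tendsto_one_div_add_atTop_nhds_zero_nat`,
`tendsto_nhds_unique`.

## References

* A. J. Majda, A. L. Bertozzi, *Vorticity and Incompressible Flow* (CUP 2002), §2.4.1 Prop. 2.16,
  (2.92)–(2.95) (Hodge decomposition, Biot–Savart law). [MajdaBertozziCUP2002]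
* Th. Gallay, V. Šverák, *Remarks on the Cauchy problem for the axisymmetric Navier–Stokes
  equations*, Confluentes Math. 7 (2015) 67–92 = arXiv:1510.01036, p. 3 (1.3), p. 6 (2.8), p. 17
  (5.12). [GallaySverak2016]
* T. Tao, *Localisation and compactness properties of the Navier–Stokes global regularity problem*,
  Anal. PDE 6 (2013), Thm. 5.4 (the smooth `H¹` class). [Tao2011]
-/

noncomputable section

open MeasureTheory Set Function Filter Metric Real InnerProductSpace
open _root_.Topology
open scoped ENNReal NNReal RealInnerProductSpace Laplacian ContDiff

namespace Literature.Analysis.FluidPDE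

/-! ### The local Helmholtz identity at a point, at scale `ρ` -/

section Representation

variable {v : (EuclideanSpace ℝ (Fin 3)) → (EuclideanSpace ℝ (Fin 3))}

/-- The gradient of the scale-`ρ` cutoff is `C¹`. [folklore] -/
private theorem contDiff_gradient_suppCutoff_scale (x : (EuclideanSpace ℝ (Fin 3))) (ρ : ℝ) :
    ContDiff ℝ 1 (gradient (suppCutoff x ρ)) :=
  (InnerProductSpace.toDual ℝ (EuclideanSpace ℝ (Fin 3))).symm.contDiff.comp
    ((contDiff_suppCutoff x ρ (n := 2)).fderiv_right (m := 1) (by norm_cast))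

/-- The gradient of the scale-`ρ` cutoff has compact support. [folklore] -/
private theorem hasCompactSupport_gradient_suppCutoff_scale (x : (EuclideanSpace ℝ (Fin 3))) {ρ : ℝ}
    (hρ : 0 < ρ) : HasCompactSupport (gradient (suppCutoff x ρ)) :=
  ((hasCompactSupport_suppCutoff x hρ).fderiv (𝕜 := ℝ)).comp_left
    (g := (InnerProductSpace.toDual ℝ (EuclideanSpace ℝ (Fin 3))).symm) (map_zero _)

/-- **The local Helmholtz identity at a point, at scale `ρ`.** For a `C²` divergence-free field `v`,
`ρ > 0` and the smooth cutoff `φ = suppCutoff x ρ` (`= 1` on `B̄(x, ρ)`, supported in `B̄(x, 2ρ)`):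
`v(x) = (K ∗ curl(φv))(x) + ∑ⱼ (∫ ∂ⱼΓ(x − y) ⟪v(y), ∇φ(y)⟫ dy) eⱼ`. Same proof as the tree's
scale-one identity `eq_biotSavart_curl_smul_add`: `K ∗ Φ = −Γ ∗ curl Φ` for `Φ = curl(φv)`,
`curl curl = ∇ div − Δ`, Green's representation `Γ ∗ Δ(φv) = φv`, the weak gradient of `Γ` and
`div(φv) = ⟪v, ∇φ⟫` — the Helmholtz decomposition of the compactly supported field `φv`
(Majda–Bertozzi §2.4.1) read off at the centre of the cutoff.
[cite: MajdaBertozziCUP2002, §2.4.1 Prop. 2.16 (2.92)–(2.95)] -/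
theorem eq_biotSavart_curl_suppCutoff_smul_add (hv : ContDiff ℝ 2 v)
    (hdiv : VectorCalculus.IsDivFree v) {ρ : ℝ} (hρ : 0 < ρ) (x : (EuclideanSpace ℝ (Fin 3))) :
    v x = biotSavart (curl fun y => suppCutoff x ρ y • v y) x +
      ∑ j, (∫ y, fderiv ℝ newtonKernel (x - y) (EuclideanSpace.single (j : Fin 3) (1 : ℝ)) *
        ⟪v y, gradient (suppCutoff x ρ) y⟫) • (EuclideanSpace.single (j : Fin 3) (1 : ℝ)) := by
  -- the localised field `W = φ v` and its companions
  set φ : (EuclideanSpace ℝ (Fin 3)) → ℝ := suppCutoff x ρ with hφdef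
  have hφ2 : ContDiff ℝ 2 φ := contDiff_suppCutoff x ρ (n := 2)
  have hφc : HasCompactSupport φ := hasCompactSupport_suppCutoff x hρ
  set W : (EuclideanSpace ℝ (Fin 3)) → (EuclideanSpace ℝ (Fin 3)) := fun y => φ y • v y with hWdef
  have hW : ContDiff ℝ 2 W := hφ2.smul hv
  have hWc : HasCompactSupport W := hφc.smul_right
  have hcW : ContDiff ℝ 1 (curl W) := contDiff_curl (n := 1) (by exact hW)
  have hcWc : HasCompactSupport (curl W) := hasCompactSupport_curl hWc
  have hccWc : HasCompactSupport (curl (curl W)) := hasCompactSupport_curl hcWc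
  have hccW : Continuous (curl (curl W)) := continuous_curl hcW
  -- `div W = ⟪v, ∇φ⟫`
  set f : (EuclideanSpace ℝ (Fin 3)) → ℝ := fun y => ⟪v y, gradient φ y⟫ with hfdef
  have hdivW : VectorCalculus.divergence W = f := by
    funext y
    rw [hWdef, divergence_smul_apply (hφ2.differentiable (by norm_num) y)
      (hv.differentiable (by norm_num) y), hdiv y, mul_zero, zero_add]
  have hv1 : ContDiff ℝ 1 v := hv.of_le (by norm_num)
  have hf1 : ContDiff ℝ 1 f := ContDiff.inner ℝ hv1 (contDiff_gradient_suppCutoff_scale x ρ)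
  have hfc : HasCompactSupport f := by
    refine (hasCompactSupport_gradient_suppCutoff_scale x hρ).mono ?_
    intro y hy
    rw [mem_support] at hy ⊢
    intro h
    have h' : gradient φ y = 0 := by rw [hφdef]; exact h
    exact hy (show ⟪v y, gradient φ y⟫ = 0 by rw [h', inner_zero_right])
  -- the Laplacian
  have hΔc : Continuous (Δ W) := (contDiff_laplacian (n := 0) (by exact hW)).continuous
  have hΔs : HasCompactSupport (Δ W) :=
    HasCompactSupport.of_support_subset_isCompact hWc.isCompact fun y hy => by
      by_contra h
      exact hy (laplacian_eq_zero_of_notMem_tsupport h)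
  -- `curl curl W = G − ΔW`, `G = ∑ᵢ ∂ᵢ f eᵢ`
  set G : (EuclideanSpace ℝ (Fin 3)) → (EuclideanSpace ℝ (Fin 3)) := fun y =>
    ∑ i, (fderiv ℝ f y (EuclideanSpace.single (i : Fin 3) (1 : ℝ))) •
      (EuclideanSpace.single (i : Fin 3) (1 : ℝ)) with hGdef
  have hccW_eq : ∀ y, curl (curl W) y = G y - (Δ W) y := fun y => by
    rw [curl_curl_eq_sum_fderiv_divergence_sub_laplacian hW y, hdivW]
  -- integrability against `Γ(x − ·)`
  have IΔ : Integrable fun y => newtonKernel (x - y) • (Δ W) y :=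
    integrable_newtonKernel_smul hΔc hΔs x
  have Icc : Integrable fun y => newtonKernel (x - y) • curl (curl W) y :=
    integrable_newtonKernel_smul hccW hccWc x
  have IG : Integrable fun y => newtonKernel (x - y) • G y := by
    have h := Icc.add IΔ
    refine h.congr (Eventually.of_forall fun y => ?_)
    show newtonKernel (x - y) • curl (curl W) y + newtonKernel (x - y) • (Δ W) y = _
    rw [hccW_eq, smul_sub, sub_add_cancel]
  have Ii : ∀ i : Fin 3, Integrable fun y =>
      newtonKernel (x - y) * fderiv ℝ f y (EuclideanSpace.single (i : Fin 3) (1 : ℝ)) := fun i => by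
    have h := integrable_newtonKernel_smul (F := ℝ)
      ((hf1.continuous_fderiv one_ne_zero).clm_apply continuous_const)
      (hfc.fderiv_apply (𝕜 := ℝ) (EuclideanSpace.single (i : Fin 3) (1 : ℝ))) x
    simpa only [smul_eq_mul] using h
  -- `∫ Γ • G = ∑ⱼ (∫ ∂ⱼΓ(x − y) f(y)) eⱼ`
  have hG : ∫ y, newtonKernel (x - y) • G y =
      ∑ j, (∫ y, fderiv ℝ newtonKernel (x - y) (EuclideanSpace.single (j : Fin 3) (1 : ℝ)) * f y) •
        (EuclideanSpace.single (j : Fin 3) (1 : ℝ)) := by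
    have hexp : (fun y => newtonKernel (x - y) • G y) =
        fun y => ∑ j, (newtonKernel (x - y) *
          fderiv ℝ f y (EuclideanSpace.single (j : Fin 3) (1 : ℝ))) •
            (EuclideanSpace.single (j : Fin 3) (1 : ℝ)) := by
      funext y
      rw [hGdef, Finset.smul_sum]
      refine Finset.sum_congr rfl fun j _ => ?_
      rw [smul_smul]
    rw [hexp, integral_finsetSum _ fun j _ => (Ii j).smul_const _]
    refine Finset.sum_congr rfl fun j _ => ?_
    rw [integral_smul_const]
    congr 1
    have h := integral_newtonKernel_smul_fderiv_eq (F := ℝ) hf1 hfc x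
      (EuclideanSpace.single (j : Fin 3) (1 : ℝ))
    simpa only [smul_eq_mul] using h
  -- Green
  have hGreen : ∫ y, newtonKernel (x - y) • (Δ W) y = v x := by
    rw [integral_newtonKernel_smul_laplacian hW hWc x, hWdef]
    simp only [hφdef, suppCutoff_eq_one hρ (by rw [sub_self, norm_zero]; exact hρ.le : ‖x - x‖ ≤ ρ),
      one_smul]
  -- assemble
  have h1 := biotSavart_eq_neg_integral_newtonKernel_smul_curl hcW hcWc x
  have h2 : ∫ y, newtonKernel (x - y) • curl (curl W) y =
      (∫ y, newtonKernel (x - y) • G y) - ∫ y, newtonKernel (x - y) • (Δ W) y := by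
    rw [← integral_sub IG IΔ]
    refine integral_congr_ae (Eventually.of_forall fun y => ?_)
    show newtonKernel (x - y) • curl (curl W) y =
      newtonKernel (x - y) • G y - newtonKernel (x - y) • (Δ W) y
    rw [hccW_eq, smul_sub]
  rw [h1, h2, hGreen, hG]
  abel

end Representation

/-! ### Tools: the shell majorant at scale `ρ`, and the `L²` tail bound on a large ball -/

section Tools

/-- **The shell majorant.** With the universal cutoff constant `B`
(`‖D(radialCutoff ε 2ε)‖ ≤ B ε⁻¹`): for `ρ > 0` and all `y`,
`‖Dφ_ρ(y)‖ · |x − y|⁻² ≤ B ρ⁻³ · 1_{B̄(x, 2ρ)}(y)` — the derivative of `φ_ρ = suppCutoff x ρ` lives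
on the shell `ρ ≤ |y − x| ≤ 2ρ`, where `|x − y|⁻² ≤ ρ⁻²`. [folklore] -/
private theorem norm_fderiv_suppCutoff_mul_inv_sq_le {B : ℝ}
    (hB : ∀ ε : ℝ, 0 < ε → ∀ z : EuclideanSpace ℝ (Fin 3),
      ‖fderiv ℝ (radialCutoff ε (2 * ε)) z‖ ≤ B * ε⁻¹)
    (hB0 : 0 ≤ B) (x : EuclideanSpace ℝ (Fin 3)) {ρ : ℝ} (hρ : 0 < ρ) (y : EuclideanSpace ℝ (Fin 3)) :
    ‖fderiv ℝ (suppCutoff x ρ) y‖ * (‖x - y‖ ^ 2)⁻¹ ≤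
      B * (ρ ^ 3)⁻¹ * (closedBall x (2 * ρ)).indicator (fun _ => (1 : ℝ)) y := by
  have hind0 : 0 ≤ (closedBall x (2 * ρ)).indicator (fun _ => (1 : ℝ)) y :=
    indicator_nonneg (fun _ _ => zero_le_one) y
  by_cases h1 : ‖y - x‖ < ρ
  · rw [fderiv_suppCutoff_eq_zero hρ h1, norm_zero, zero_mul]
    positivity
  by_cases h2 : 2 * ρ < ‖y - x‖
  · rw [fderiv_suppCutoff_eq_zero_of_lt hρ h2, norm_zero, zero_mul]
    positivity
  · have hy2 : y ∈ closedBall x (2 * ρ) := by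
      rw [mem_closedBall, dist_eq_norm]; exact not_lt.1 h2
    rw [indicator_of_mem hy2, mul_one]
    have hxy : ρ ≤ ‖x - y‖ := by rw [norm_sub_rev]; exact not_lt.1 h1
    have hinv : (‖x - y‖ ^ 2)⁻¹ ≤ (ρ ^ 2)⁻¹ := by
      refine inv_anti₀ (by positivity) ?_
      exact pow_le_pow_left₀ hρ.le hxy 2
    calc ‖fderiv ℝ (suppCutoff x ρ) y‖ * (‖x - y‖ ^ 2)⁻¹ ≤ (B * ρ⁻¹) * (ρ ^ 2)⁻¹ :=
          mul_le_mul (norm_fderiv_suppCutoff_le hB x hρ y) hinv (by positivity) (by positivity)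
      _ = B * (ρ ^ 3)⁻¹ := by
          field_simp

/-- **`L²` bound for the mass of `v` on a large ball, linear in `ρ⁻¹` after the `ρ⁻³` weight**:
for a continuous `v` with `S = ∫‖v‖² < ∞` and `ρ ≥ 1`,
`ρ⁻³ ∫_{B̄(x, 2ρ)} ‖v‖ ≤ ((8|B̄₁| + S)/2) ρ⁻¹`. Proof: `ρ⁻³‖v‖ 1_{B̄} ≤ (ρ⁻¹ 1_{B̄} ρ⁻⁶ ρ… )` — precisely,
`‖v‖ 1_{B̄} ≤ (ε 1_{B̄} + ε⁻¹‖v‖²)/2` with `ε = ρ⁻¹`, `|B̄(x, 2ρ)| = (2ρ)³ |B̄₁|`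
(`Measure.addHaar_closedBall`), and `ρ⁻² ≤ ρ⁻¹` for `ρ ≥ 1`. No Hölder inequality is used. [folklore] -/
private theorem inv_cube_mul_integral_indicator_norm_le
    {v : EuclideanSpace ℝ (Fin 3) → EuclideanSpace ℝ (Fin 3)} (hvc : Continuous v)
    (hv2 : Integrable fun y => ‖v y‖ ^ 2) (x : EuclideanSpace ℝ (Fin 3)) {ρ : ℝ} (hρ : 1 ≤ ρ) :
    (ρ ^ 3)⁻¹ * ∫ y, (closedBall x (2 * ρ)).indicator (fun _ => (1 : ℝ)) y * ‖v y‖ ≤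
      ((8 * (volume (ball (0 : EuclideanSpace ℝ (Fin 3)) 1)).toReal + ∫ y, ‖v y‖ ^ 2) / 2) *
        ρ⁻¹ := by
  have hρ0 : 0 < ρ := lt_of_lt_of_le one_pos hρ
  set S : ℝ := ∫ y, ‖v y‖ ^ 2 with hS
  set V₁ : ℝ := (volume (ball (0 : EuclideanSpace ℝ (Fin 3)) 1)).toReal with hV₁
  have hS0 : 0 ≤ S := integral_nonneg fun y => sq_nonneg _
  have hV₁0 : 0 ≤ V₁ := ENNReal.toReal_nonneg
  set χ : EuclideanSpace ℝ (Fin 3) → ℝ := (closedBall x (2 * ρ)).indicator (fun _ => (1 : ℝ)) with hχ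
  have hχ0 : ∀ y, 0 ≤ χ y := fun y => indicator_nonneg (fun _ _ => zero_le_one) y
  have hχ1 : ∀ y, χ y ≤ 1 := fun y =>
    indicator_le_self' (fun _ _ => zero_le_one) y |>.trans le_rfl
  have hχsq : ∀ y, χ y * χ y = χ y := fun y => by
    by_cases hy : y ∈ closedBall x (2 * ρ)
    · simp [hχ, indicator_of_mem hy]
    · simp [hχ, indicator_of_notMem hy]
  have hχi : Integrable χ := by
    rw [hχ, integrable_indicator_iff measurableSet_closedBall]
    exact integrableOn_const measure_closedBall_lt_top.ne
  -- the pointwise AM–GM inequality with `ε = ρ⁻¹`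
  have hpt : ∀ y, χ y * ‖v y‖ ≤ (ρ⁻¹ * χ y + ρ * ‖v y‖ ^ 2) / 2 := by
    intro y
    have key : ρ * (2 * (χ y * ‖v y‖)) ≤ ρ * (ρ⁻¹ * χ y + ρ * ‖v y‖ ^ 2) := by
      have e : ρ * (ρ⁻¹ * χ y) = χ y := by rw [← mul_assoc, mul_inv_cancel₀ hρ0.ne', one_mul]
      rw [mul_add, e]
      nlinarith [sq_nonneg (χ y - ρ * ‖v y‖), hχsq y]
    have h2 := le_of_mul_le_mul_left key hρ0
    linarith
  have hint_rhs : Integrable fun y => (ρ⁻¹ * χ y + ρ * ‖v y‖ ^ 2) / 2 :=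
    ((hχi.const_mul _).add (hv2.const_mul _)).div_const 2
  have hint_lhs : Integrable fun y => χ y * ‖v y‖ := by
    refine hint_rhs.mono' ?_ (Eventually.of_forall fun y => ?_)
    · exact ((Measurable.indicator measurable_const measurableSet_closedBall).aestronglyMeasurable.mul
        hvc.norm.aestronglyMeasurable)
    · rw [Real.norm_of_nonneg (mul_nonneg (hχ0 y) (norm_nonneg _))]
      exact hpt y
  have hvol : ∫ y, χ y = (2 * ρ) ^ 3 * V₁ := by
    rw [hχ, integral_indicator_const _ measurableSet_closedBall, smul_eq_mul, mul_one,
      measureReal_def, Measure.addHaar_closedBall _ _ (by positivity), ENNReal.toReal_mul,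
      finrank_euclideanSpace_fin, ENNReal.toReal_ofReal (by positivity)]
  have hI : ∫ y, χ y * ‖v y‖ ≤ (ρ⁻¹ * ((2 * ρ) ^ 3 * V₁) + ρ * S) / 2 := by
    calc ∫ y, χ y * ‖v y‖ ≤ ∫ y, (ρ⁻¹ * χ y + ρ * ‖v y‖ ^ 2) / 2 :=
          integral_mono hint_lhs hint_rhs hpt
      _ = (ρ⁻¹ * ((2 * ρ) ^ 3 * V₁) + ρ * S) / 2 := by
          rw [integral_div, integral_add (hχi.const_mul _) (hv2.const_mul _), integral_const_mul,
            integral_const_mul, hvol]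
  -- multiply by `ρ⁻³` and use `ρ ≥ 1`
  have hρ3 : 0 < ρ ^ 3 := by positivity
  calc (ρ ^ 3)⁻¹ * ∫ y, χ y * ‖v y‖ ≤ (ρ ^ 3)⁻¹ * ((ρ⁻¹ * ((2 * ρ) ^ 3 * V₁) + ρ * S) / 2) :=
        mul_le_mul_of_nonneg_left hI (by positivity)
    _ = (8 * V₁ * ρ⁻¹ + S * (ρ ^ 2)⁻¹) / 2 := by
        field_simp
        ring
    _ ≤ (8 * V₁ * ρ⁻¹ + S * ρ⁻¹) / 2 := by
        have h : (ρ ^ 2)⁻¹ ≤ ρ⁻¹ := by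
          refine inv_anti₀ hρ0 ?_
          nlinarith
        have := mul_le_mul_of_nonneg_left h hS0
        linarith
    _ = ((8 * V₁ + S) / 2) * ρ⁻¹ := by ring

/-- **The dominating function of the Biot–Savart integrand for `ω ∈ C ∩ L²`.** For `ω` continuous
with `∫‖ω‖² < ∞` and any `x`, the function `y ↦ (4π)⁻¹ ‖ω(y)‖ |x − y|⁻²` is integrable: near `x`
(`|x − y| < 1`) it is at most `(4π)⁻¹ (sup_{B̄(x,1)}‖ω‖) |x − y|⁻²` (`kernelMajorant`), and away from
`x` at most `((4π)⁻¹/2)(‖ω(y)‖² + |x − y|⁻⁴ 1_{|x−y| ≥ 1})` (`ab ≤ (a² + b²)/2`; the far kernel is in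
`L²`, `memLp_two_farKernel`). [folklore] -/
private theorem integrable_norm_mul_inv_sq {w : EuclideanSpace ℝ (Fin 3) → EuclideanSpace ℝ (Fin 3)}
    (hωc : Continuous w) (hω2 : Integrable fun y => ‖w y‖ ^ 2) (x : EuclideanSpace ℝ (Fin 3)) :
    Integrable fun y => (4 * π)⁻¹ * ‖w y‖ * (‖x - y‖ ^ 2)⁻¹ := by
  -- a bound for `ω` on the closed unit ball about `x`
  obtain ⟨M, hM⟩ := (isCompact_closedBall x 1).exists_bound_of_continuousOn hωc.continuousOn
  have hM0 : 0 ≤ M := (norm_nonneg _).trans (hM x (mem_closedBall_self zero_le_one))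
  -- the far kernel and its square
  set kf : EuclideanSpace ℝ (Fin 3) → ℝ := fun z =>
    (ball (0 : EuclideanSpace ℝ (Fin 3)) 1)ᶜ.indicator (fun z => (‖z‖ ^ 2)⁻¹) z with hkf
  have hkf0 : ∀ z, 0 ≤ kf z := fun z => by
    rw [hkf]; exact indicator_nonneg (fun _ _ => by positivity) z
  have hkf2 : Integrable fun z => kf z ^ 2 := by
    have h := memLp_two_farKernel
    have h2 : ENNReal.ofReal 2 = (2 : ℝ≥0∞) := by norm_num
    rw [h2, memLp_two_iff_integrable_sq_norm h.1] at h
    refine h.congr (Eventually.of_forall fun z => ?_)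
    show ‖kf z‖ ^ 2 = kf z ^ 2
    rw [Real.norm_of_nonneg (hkf0 z)]
  have hkf2x : Integrable fun y => kf (x - y) ^ 2 := hkf2.comp_sub_left x
  -- the majorant: near part + far part
  set g : EuclideanSpace ℝ (Fin 3) → ℝ := fun y =>
    (4 * π)⁻¹ * M * kernelMajorant 1 (x - y) +
      (4 * π)⁻¹ / 2 * (‖w y‖ ^ 2 + kf (x - y) ^ 2) with hg
  have hgi : Integrable g := by
    rw [hg]
    exact (((integrable_kernelMajorant 1).comp_sub_left x).const_mul _).add
      ((hω2.add hkf2x).const_mul _)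
  have hmeas : AEStronglyMeasurable (fun y => (4 * π)⁻¹ * ‖w y‖ * (‖x - y‖ ^ 2)⁻¹) volume := by
    refine ((continuous_const.mul hωc.norm).measurable.mul ?_).aestronglyMeasurable
    exact ((continuous_const.sub continuous_id).norm.pow 2).measurable.inv
  refine hgi.mono' hmeas (Eventually.of_forall fun y => ?_)
  rw [Real.norm_of_nonneg (by positivity)]
  have hπ : 0 < (4 * π)⁻¹ := by positivity
  by_cases hy : ‖x - y‖ < 1
  · -- near: `‖w y‖ ≤ M`, kernel = kernelMajorant
    have hmem : x - y ∈ ball (0 : EuclideanSpace ℝ (Fin 3)) 1 := by rwa [mem_ball_zero_iff]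
    have hk : kernelMajorant 1 (x - y) = (‖x - y‖ ^ 2)⁻¹ := by
      rw [kernelMajorant, indicator_of_mem hmem]
    have hyM : ‖w y‖ ≤ M := hM y (by rw [mem_closedBall, dist_eq_norm, norm_sub_rev]; exact hy.le)
    have hfar0 : 0 ≤ (4 * π)⁻¹ / 2 * (‖w y‖ ^ 2 + kf (x - y) ^ 2) := by positivity
    calc (4 * π)⁻¹ * ‖w y‖ * (‖x - y‖ ^ 2)⁻¹ ≤ (4 * π)⁻¹ * M * (‖x - y‖ ^ 2)⁻¹ := by
          gcongr
      _ = (4 * π)⁻¹ * M * kernelMajorant 1 (x - y) := by rw [hk]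
      _ ≤ g y := by rw [hg]; linarith
  · -- far: `ab ≤ (a² + b²)/2` with the far kernel
    have hmem : x - y ∈ (ball (0 : EuclideanSpace ℝ (Fin 3)) 1)ᶜ := by
      rw [mem_compl_iff, mem_ball_zero_iff]; exact hy
    have hk : kf (x - y) = (‖x - y‖ ^ 2)⁻¹ := by rw [hkf]; exact indicator_of_mem hmem _
    have hnear0 : 0 ≤ (4 * π)⁻¹ * M * kernelMajorant 1 (x - y) :=
      mul_nonneg (by positivity) (kernelMajorant_nonneg _ _)
    have hamgm : ‖w y‖ * (‖x - y‖ ^ 2)⁻¹ ≤ (‖w y‖ ^ 2 + kf (x - y) ^ 2) / 2 := by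
      rw [← hk]
      nlinarith [sq_nonneg (‖w y‖ - kf (x - y))]
    calc (4 * π)⁻¹ * ‖w y‖ * (‖x - y‖ ^ 2)⁻¹ = (4 * π)⁻¹ * (‖w y‖ * (‖x - y‖ ^ 2)⁻¹) := by ring
      _ ≤ (4 * π)⁻¹ * ((‖w y‖ ^ 2 + kf (x - y) ^ 2) / 2) := mul_le_mul_of_nonneg_left hamgm hπ.le
      _ = (4 * π)⁻¹ / 2 * (‖w y‖ ^ 2 + kf (x - y) ^ 2) := by ring
      _ ≤ g y := by rw [hg]; linarith

end Tools

/-! ### The representation theorem -/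

section Main

variable {v : (EuclideanSpace ℝ (Fin 3)) → (EuclideanSpace ℝ (Fin 3))}

/-- **Biot–Savart representation for square-integrable fields.** Let `v ∈ C²(ℝ³; ℝ³)` be divergence
free with `∫ ‖v‖² < ∞` and `∫ ‖curl v‖² < ∞`. Then `K₃ ∗ curl v = v` everywhere — no integrability of
`curl v`, no decay of `v` or `curl v` at infinity is assumed (compare the tree's
`biotSavart_curl_eq_self_holds`: `curl v ∈ L¹ ∩ L^∞`, `v → 0`). Proof: in the scale-`ρ` local
Helmholtz identity `eq_biotSavart_curl_suppCutoff_smul_add`, `curl(φ_ρ v) = φ_ρ ω + Dφ_ρ ⊗ v`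
(`curl_smul`, `ω = curl v`); the cutoff term of the Biot–Savart integral and the pressure-like sum
are both bounded by `(4π)⁻¹ B ρ⁻³ ∫_{B̄(x,2ρ)}‖v‖ ≤ A(1 + ‖v‖₂²)ρ⁻¹ → 0`
(`norm_fderiv_suppCutoff_mul_inv_sq_le`, `inv_cube_mul_integral_indicator_norm_le`), while
`(K₃ ∗ φ_ρ ω)(x) → (K₃ ∗ ω)(x)` by dominated convergence (integrand eventually constant in `ρ`,
dominated by `(4π)⁻¹‖ω‖|x − ·|⁻² ∈ L¹`, `integrable_norm_mul_inv_sq`); the constant sequence `v(x)`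
therefore tends to `(K₃ ∗ ω)(x)`. (Majda–Bertozzi, Prop. 2.16: the Hodge decomposition
`ω`-part; their statement is for smooth rapidly decaying vorticity, the `L²` form is what the local
identity gives.) [cite: MajdaBertozziCUP2002, §2.4.1 Prop. 2.16 (2.92)–(2.95)] -/
theorem biotSavart_curl_eq_self_of_lintegral_sq_lt_top (hv : ContDiff ℝ 2 v)
    (hdiv : VectorCalculus.IsDivFree v) (hv2 : ∫⁻ y, ‖v y‖ₑ ^ 2 < ⊤)
    (hω2 : ∫⁻ y, ‖curl v y‖ₑ ^ 2 < ⊤) : biotSavart (curl v) = v := by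
  funext x
  obtain ⟨B, hB0, hB⟩ := exists_norm_fderiv_radialCutoff_le
  have hv1 : ContDiff ℝ 1 v := hv.of_le (by norm_num)
  have hvc : Continuous v := hv.continuous
  have hvd : Differentiable ℝ v := hv1.differentiable one_ne_zero
  set w : EuclideanSpace ℝ (Fin 3) → EuclideanSpace ℝ (Fin 3) := curl v with hwdef
  have hωc : Continuous w := continuous_curl hv1
  have hv2i : Integrable fun y => ‖v y‖ ^ 2 := integrable_sq_norm_of_lintegral_lt_top hvc hv2
  have hω2i : Integrable fun y => ‖w y‖ ^ 2 := integrable_sq_norm_of_lintegral_lt_top hωc hω2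
  set S : ℝ := ∫ y, ‖v y‖ ^ 2 with hS
  set V₁ : ℝ := (volume (ball (0 : EuclideanSpace ℝ (Fin 3)) 1)).toReal with hV₁
  set A : ℝ := (4 * π)⁻¹ * B * ((8 * V₁ + S) / 2) with hA
  have hS0 : 0 ≤ S := integral_nonneg fun y => sq_nonneg _
  have hV₁0 : 0 ≤ V₁ := ENNReal.toReal_nonneg
  have hA0 : 0 ≤ A := by positivity
  -- the scale of the `n`-th cutoff
  set ρ : ℕ → ℝ := fun n => (n : ℝ) + 1 with hρdef
  have hρ0 : ∀ n, 0 < ρ n := fun n => by rw [hρdef]; positivity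
  have hρ1 : ∀ n, 1 ≤ ρ n := fun n => by
    show (1 : ℝ) ≤ (n : ℝ) + 1
    linarith [(Nat.cast_nonneg n : (0 : ℝ) ≤ n)]
  -- the cutoffs
  set φ : ℕ → EuclideanSpace ℝ (Fin 3) → ℝ := fun n => suppCutoff x (ρ n) with hφdef
  have hφ1 : ∀ n, ContDiff ℝ 1 (φ n) := fun n => contDiff_suppCutoff x (ρ n) (n := 1)
  have hφd : ∀ n, Differentiable ℝ (φ n) := fun n => (hφ1 n).differentiable one_ne_zero
  have hφc : ∀ n, HasCompactSupport (φ n) := fun n => hasCompactSupport_suppCutoff x (hρ0 n)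
  -- the three sequences: main Biot–Savart term, cutoff remainder, pressure-like sum
  set main : ℕ → EuclideanSpace ℝ (Fin 3) := fun n =>
    ∫ y, biotSavartKernel (x - y) (φ n y • w y) with hmain
  set rem : ℕ → EuclideanSpace ℝ (Fin 3) := fun n =>
    ∫ y, biotSavartKernel (x - y) (curlCLM ((fderiv ℝ (φ n) y).smulRight (v y))) with hrem
  set prs : ℕ → EuclideanSpace ℝ (Fin 3) := fun n =>
    ∑ j, (∫ y, fderiv ℝ newtonKernel (x - y) (EuclideanSpace.single (j : Fin 3) (1 : ℝ)) *
      ⟪v y, gradient (φ n) y⟫) • (EuclideanSpace.single (j : Fin 3) (1 : ℝ)) with hprs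
  -- (1) the identity at every scale: `v x = main n + rem n + prs n`
  have hid : ∀ n, v x = main n + rem n + prs n := by
    intro n
    have h := eq_biotSavart_curl_suppCutoff_smul_add hv hdiv (hρ0 n) x
    -- split the curl of the localised field
    have hsplit : ∀ y, curl (fun y => φ n y • v y) y =
        φ n y • w y + curlCLM ((fderiv ℝ (φ n) y).smulRight (v y)) := fun y =>
      curl_smul ((hφd n) y) (hvd y)
    have hs₁c : Continuous fun y => φ n y • w y := (hφ1 n).continuous.smul hωc
    have hs₁s : HasCompactSupport fun y => φ n y • w y := (hφc n).smul_right
    -- the remainder is `curl(φ v) − φ ω`: continuous with compact support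
    have hrem_eq : (fun y => curlCLM ((fderiv ℝ (φ n) y).smulRight (v y))) =
        fun y => curl (fun y => φ n y • v y) y - φ n y • w y := by
      funext y
      rw [hsplit y, add_sub_cancel_left]
    have hWs : HasCompactSupport ((φ n) • v) := (hφc n).smul_right
    have hs₂c : Continuous fun y => curlCLM ((fderiv ℝ (φ n) y).smulRight (v y)) := by
      rw [hrem_eq]
      exact (continuous_curl ((hφ1 n).smul hv1)).sub hs₁c
    have hs₂s : HasCompactSupport fun y => curlCLM ((fderiv ℝ (φ n) y).smulRight (v y)) := by
      rw [hrem_eq]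
      exact (hasCompactSupport_curl hWs).sub hs₁s
    have I₁ := integrable_biotSavartKernel_sub_apply_of_hasCompactSupport hs₁c hs₁s x
    have I₂ := integrable_biotSavartKernel_sub_apply_of_hasCompactSupport hs₂c hs₂s x
    have hBS : biotSavart (curl fun y => φ n y • v y) x = main n + rem n := by
      rw [biotSavart, hmain, hrem, ← integral_add I₁ I₂]
      refine integral_congr_ae (Eventually.of_forall fun y => ?_)
      show biotSavartKernel (x - y) (curl (fun y => φ n y • v y) y) =
        biotSavartKernel (x - y) (φ n y • w y) +
          biotSavartKernel (x - y) (curlCLM ((fderiv ℝ (φ n) y).smulRight (v y)))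
      rw [← biotSavartCLM_apply, ← biotSavartCLM_apply, ← biotSavartCLM_apply, hsplit, map_add]
    rw [h, hBS]
  -- (2) the common shell majorant and its integral
  have hg : ∀ n, Integrable (fun y =>
      (closedBall x (2 * ρ n)).indicator (fun _ => (1 : ℝ)) y * ‖v y‖) ∧
      (ρ n ^ 3)⁻¹ * ∫ y, (closedBall x (2 * ρ n)).indicator (fun _ => (1 : ℝ)) y * ‖v y‖ ≤
        ((8 * V₁ + S) / 2) * (ρ n)⁻¹ := by
    intro n
    refine ⟨?_, inv_cube_mul_integral_indicator_norm_le hvc hv2i x (hρ1 n)⟩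
    have h1 : Integrable ((closedBall x (2 * ρ n)).indicator fun y => ‖v y‖) := by
      rw [integrable_indicator_iff measurableSet_closedBall]
      exact hvc.norm.continuousOn.integrableOn_compact (isCompact_closedBall x _)
    refine h1.congr (Eventually.of_forall fun y => ?_)
    by_cases hy : y ∈ closedBall x (2 * ρ n)
    · simp only [indicator_of_mem hy, one_mul]
    · simp only [indicator_of_notMem hy, zero_mul]
  have hshell : ∀ n y, ‖fderiv ℝ (φ n) y‖ * (‖x - y‖ ^ 2)⁻¹ ≤
      B * (ρ n ^ 3)⁻¹ * (closedBall x (2 * ρ n)).indicator (fun _ => (1 : ℝ)) y := fun n y =>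
    norm_fderiv_suppCutoff_mul_inv_sq_le hB hB0 x (hρ0 n) y
  -- (3) the cutoff remainder of the Biot–Savart integral is `≤ ‖curlCLM‖ A ρ⁻¹`
  have hrem_le : ∀ n, ‖rem n‖ ≤ ‖curlCLM‖ * A * (ρ n)⁻¹ := by
    intro n
    obtain ⟨hgi, hgle⟩ := hg n
    set g : EuclideanSpace ℝ (Fin 3) → ℝ := fun y => (4 * π)⁻¹ * ‖curlCLM‖ * B * (ρ n ^ 3)⁻¹ *
      ((closedBall x (2 * ρ n)).indicator (fun _ => (1 : ℝ)) y * ‖v y‖) with hgdef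
    have hgint : Integrable g := hgi.const_mul _
    have hpt : ∀ y, ‖biotSavartKernel (x - y) (curlCLM ((fderiv ℝ (φ n) y).smulRight (v y)))‖ ≤
        g y := by
      intro y
      calc ‖biotSavartKernel (x - y) (curlCLM ((fderiv ℝ (φ n) y).smulRight (v y)))‖
          ≤ (4 * π)⁻¹ * ‖curlCLM ((fderiv ℝ (φ n) y).smulRight (v y))‖ * (‖x - y‖ ^ 2)⁻¹ :=
            norm_biotSavartKernel_le _ _
        _ ≤ (4 * π)⁻¹ * (‖curlCLM‖ * (‖fderiv ℝ (φ n) y‖ * ‖v y‖)) * (‖x - y‖ ^ 2)⁻¹ := by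
            gcongr
            calc ‖curlCLM ((fderiv ℝ (φ n) y).smulRight (v y))‖
                ≤ ‖curlCLM‖ * ‖(fderiv ℝ (φ n) y).smulRight (v y)‖ := ContinuousLinearMap.le_opNorm _ _
              _ = ‖curlCLM‖ * (‖fderiv ℝ (φ n) y‖ * ‖v y‖) := by
                  rw [ContinuousLinearMap.norm_smulRight_apply]
        _ = (4 * π)⁻¹ * ‖curlCLM‖ * ((‖fderiv ℝ (φ n) y‖ * (‖x - y‖ ^ 2)⁻¹) * ‖v y‖) := by ring
        _ ≤ (4 * π)⁻¹ * ‖curlCLM‖ *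
              ((B * (ρ n ^ 3)⁻¹ * (closedBall x (2 * ρ n)).indicator (fun _ => (1 : ℝ)) y) *
                ‖v y‖) :=
            mul_le_mul_of_nonneg_left (mul_le_mul_of_nonneg_right (hshell n y) (norm_nonneg _))
              (by positivity)
        _ = g y := by rw [hgdef]; ring
    refine (norm_integral_le_of_norm_le hgint (Eventually.of_forall hpt)).trans ?_
    rw [hgdef, integral_const_mul]
    calc (4 * π)⁻¹ * ‖curlCLM‖ * B * (ρ n ^ 3)⁻¹ *
          ∫ y, (closedBall x (2 * ρ n)).indicator (fun _ => (1 : ℝ)) y * ‖v y‖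
        = (4 * π)⁻¹ * ‖curlCLM‖ * B *
            ((ρ n ^ 3)⁻¹ * ∫ y, (closedBall x (2 * ρ n)).indicator (fun _ => (1 : ℝ)) y * ‖v y‖) := by
          ring
      _ ≤ (4 * π)⁻¹ * ‖curlCLM‖ * B * (((8 * V₁ + S) / 2) * (ρ n)⁻¹) :=
          mul_le_mul_of_nonneg_left hgle (by positivity)
      _ = ‖curlCLM‖ * A * (ρ n)⁻¹ := by rw [hA]; ring
  -- (4) the pressure-like sum is `≤ 3 A ρ⁻¹`
  have he1 : ∀ j : Fin 3, ‖(EuclideanSpace.single (j : Fin 3) (1 : ℝ))‖ = 1 := fun j => by simp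
  have hprs_le : ∀ n, ‖prs n‖ ≤ 3 * A * (ρ n)⁻¹ := by
    intro n
    obtain ⟨hgi, hgle⟩ := hg n
    set g : EuclideanSpace ℝ (Fin 3) → ℝ := fun y => (4 * π)⁻¹ * B * (ρ n ^ 3)⁻¹ *
      ((closedBall x (2 * ρ n)).indicator (fun _ => (1 : ℝ)) y * ‖v y‖) with hgdef
    have hgint : Integrable g := hgi.const_mul _
    have hgI : ∫ y, g y ≤ A * (ρ n)⁻¹ := by
      rw [hgdef, integral_const_mul]
      calc (4 * π)⁻¹ * B * (ρ n ^ 3)⁻¹ *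
            ∫ y, (closedBall x (2 * ρ n)).indicator (fun _ => (1 : ℝ)) y * ‖v y‖
          = (4 * π)⁻¹ * B *
              ((ρ n ^ 3)⁻¹ * ∫ y, (closedBall x (2 * ρ n)).indicator (fun _ => (1 : ℝ)) y * ‖v y‖) := by
            ring
        _ ≤ (4 * π)⁻¹ * B * (((8 * V₁ + S) / 2) * (ρ n)⁻¹) :=
            mul_le_mul_of_nonneg_left hgle (by positivity)
        _ = A * (ρ n)⁻¹ := by rw [hA]; ring
    have hcoef : ∀ j : Fin 3,
        |∫ y, fderiv ℝ newtonKernel (x - y) (EuclideanSpace.single (j : Fin 3) (1 : ℝ)) *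
          ⟪v y, gradient (φ n) y⟫| ≤ A * (ρ n)⁻¹ := by
      intro j
      have hpt : ∀ y, ‖fderiv ℝ newtonKernel (x - y) (EuclideanSpace.single (j : Fin 3) (1 : ℝ)) *
          ⟪v y, gradient (φ n) y⟫‖ ≤ g y := by
        intro y
        rw [norm_mul, Real.norm_eq_abs, Real.norm_eq_abs]
        have h1 : |fderiv ℝ newtonKernel (x - y) (EuclideanSpace.single (j : Fin 3) (1 : ℝ))| ≤
            (4 * π * ‖x - y‖ ^ 2)⁻¹ := by
          calc |fderiv ℝ newtonKernel (x - y) (EuclideanSpace.single (j : Fin 3) (1 : ℝ))|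
              = ‖fderiv ℝ newtonKernel (x - y) (EuclideanSpace.single (j : Fin 3) (1 : ℝ))‖ :=
                (Real.norm_eq_abs _).symm
            _ ≤ ‖fderiv ℝ newtonKernel (x - y)‖ * ‖(EuclideanSpace.single (j : Fin 3) (1 : ℝ))‖ :=
                ContinuousLinearMap.le_opNorm _ _
            _ ≤ (4 * π * ‖x - y‖ ^ 2)⁻¹ * 1 := by
                gcongr
                · exact norm_fderiv_newtonKernel_le _
                · rw [he1 j]
            _ = (4 * π * ‖x - y‖ ^ 2)⁻¹ := mul_one _
        have h2 : |⟪v y, gradient (φ n) y⟫| ≤ ‖v y‖ * ‖fderiv ℝ (φ n) y‖ := by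
          calc |⟪v y, gradient (φ n) y⟫| ≤ ‖v y‖ * ‖gradient (φ n) y‖ := abs_real_inner_le_norm _ _
            _ = ‖v y‖ * ‖fderiv ℝ (φ n) y‖ := by
                rw [gradient, LinearIsometryEquiv.norm_map]
        calc |fderiv ℝ newtonKernel (x - y) (EuclideanSpace.single (j : Fin 3) (1 : ℝ))| *
              |⟪v y, gradient (φ n) y⟫|
            ≤ (4 * π * ‖x - y‖ ^ 2)⁻¹ * (‖v y‖ * ‖fderiv ℝ (φ n) y‖) :=
              mul_le_mul h1 h2 (abs_nonneg _) (by positivity)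
          _ = (4 * π)⁻¹ * ((‖fderiv ℝ (φ n) y‖ * (‖x - y‖ ^ 2)⁻¹) * ‖v y‖) := by
              rw [mul_inv]; ring
          _ ≤ (4 * π)⁻¹ *
                ((B * (ρ n ^ 3)⁻¹ * (closedBall x (2 * ρ n)).indicator (fun _ => (1 : ℝ)) y) *
                  ‖v y‖) :=
              mul_le_mul_of_nonneg_left (mul_le_mul_of_nonneg_right (hshell n y) (norm_nonneg _))
                (by positivity)
          _ = g y := by rw [hgdef]; ring
      have h := norm_integral_le_of_norm_le hgint (Eventually.of_forall hpt)
      rw [Real.norm_eq_abs] at h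
      exact h.trans hgI
    calc ‖prs n‖ ≤ ∑ j, ‖(∫ y, fderiv ℝ newtonKernel (x - y) (EuclideanSpace.single (j : Fin 3) (1 : ℝ)) *
          ⟪v y, gradient (φ n) y⟫) • (EuclideanSpace.single (j : Fin 3) (1 : ℝ))‖ := norm_sum_le _ _
      _ = ∑ j, |∫ y, fderiv ℝ newtonKernel (x - y) (EuclideanSpace.single (j : Fin 3) (1 : ℝ)) *
          ⟪v y, gradient (φ n) y⟫| := by
          refine Finset.sum_congr rfl fun j _ => ?_
          rw [norm_smul, Real.norm_eq_abs, he1 j, mul_one]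
      _ ≤ ∑ _j : Fin 3, A * (ρ n)⁻¹ := Finset.sum_le_sum fun j _ => hcoef j
      _ = 3 * A * (ρ n)⁻¹ := by
          rw [Finset.sum_const, Finset.card_univ, Fintype.card_fin]
          simp
          ring
  -- (5) the two small terms tend to `0`
  have hρinv : Tendsto (fun n => (ρ n)⁻¹) atTop (𝓝 0) := by
    have h : Tendsto (fun n : ℕ => 1 / ((n : ℝ) + 1)) atTop (𝓝 0) :=
      tendsto_one_div_add_atTop_nhds_zero_nat
    refine h.congr fun n => ?_
    show 1 / ((n : ℝ) + 1) = (ρ n)⁻¹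
    rw [hρdef, one_div]
  have hrem0 : Tendsto rem atTop (𝓝 0) := by
    refine squeeze_zero_norm hrem_le ?_
    simpa using hρinv.const_mul (‖curlCLM‖ * A)
  have hprs0 : Tendsto prs atTop (𝓝 0) := by
    refine squeeze_zero_norm hprs_le ?_
    simpa using hρinv.const_mul (3 * A)
  -- (6) the main term tends to `biotSavart w x` (dominated convergence)
  have hmain : Tendsto main atTop (𝓝 (biotSavart w x)) := by
    rw [biotSavart]
    refine tendsto_integral_of_dominated_convergence (fun y => (4 * π)⁻¹ * ‖w y‖ * (‖x - y‖ ^ 2)⁻¹)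
      (fun n => ?_) (integrable_norm_mul_inv_sq hωc hω2i x) (fun n => Eventually.of_forall fun y => ?_)
      (Eventually.of_forall fun y => ?_)
    · -- measurability
      exact (measurable_biotSavartKernel_sub_apply
        (((hφ1 n).continuous.smul hωc).measurable) x).aestronglyMeasurable
    · -- domination: `|φ| ≤ 1`
      calc ‖biotSavartKernel (x - y) (φ n y • w y)‖
          ≤ (4 * π)⁻¹ * ‖φ n y • w y‖ * (‖x - y‖ ^ 2)⁻¹ := norm_biotSavartKernel_le _ _
        _ ≤ (4 * π)⁻¹ * ‖w y‖ * (‖x - y‖ ^ 2)⁻¹ := by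
            gcongr
            rw [norm_smul, Real.norm_eq_abs]
            exact mul_le_of_le_one_left (norm_nonneg _) (abs_suppCutoff_le_one x (ρ n) y)
    · -- pointwise: the integrand is eventually constant (`φ n y = 1` once `ρ n ≥ ‖y - x‖`)
      refine tendsto_const_nhds.congr' ?_
      obtain ⟨N, hN⟩ := exists_nat_ge ‖y - x‖
      refine eventually_atTop.2 ⟨N, fun n hn => ?_⟩
      have hle : ‖y - x‖ ≤ ρ n := by
        calc ‖y - x‖ ≤ (N : ℝ) := hN
          _ ≤ (n : ℝ) := by exact_mod_cast hn
          _ ≤ ρ n := by show (n : ℝ) ≤ (n : ℝ) + 1; linarith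
      show biotSavartKernel (x - y) (w y) = biotSavartKernel (x - y) (φ n y • w y)
      rw [hφdef]
      simp only [suppCutoff_eq_one (hρ0 n) hle, one_smul]
  -- (7) conclude: the constant sequence `v x` tends to `biotSavart w x + 0 + 0`
  have hsum : Tendsto (fun n => main n + rem n + prs n) atTop (𝓝 (biotSavart w x + 0 + 0)) :=
    (hmain.add hrem0).add hprs0
  rw [add_zero, add_zero] at hsum
  have hconst : Tendsto (fun _ : ℕ => v x) atTop (𝓝 (biotSavart w x)) :=
    hsum.congr fun n => (hid n).symm
  exact tendsto_nhds_unique hconst tendsto_const_nhds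

/-- The same statement with the square-integrability hypotheses as Bochner integrability of
`‖v‖²` and `‖curl v‖²`. [cite: MajdaBertozziCUP2002, §2.4.1 Prop. 2.16 (2.92)–(2.95)] -/
theorem biotSavart_curl_eq_self_of_integrable_sq (hv : ContDiff ℝ 2 v)
    (hdiv : VectorCalculus.IsDivFree v) (hv2 : Integrable fun y => ‖v y‖ ^ 2)
    (hω2 : Integrable fun y => ‖curl v y‖ ^ 2) : biotSavart (curl v) = v := by
  have hvc : Continuous v := hv.continuous
  have hωc : Continuous (curl v) := continuous_curl (hv.of_le (by norm_num))
  refine biotSavart_curl_eq_self_of_lintegral_sq_lt_top hv hdiv ?_ ?_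
  · have hm : MemLp v 2 volume := (memLp_two_iff_integrable_sq_norm hvc.aestronglyMeasurable).2 hv2
    exact lintegral_rpow_enorm_lt_top_of_eLpNorm_lt_top two_ne_zero ENNReal.ofNat_ne_top hm.2 |>
      fun h => by simpa using h
  · have hm : MemLp (curl v) 2 volume :=
      (memLp_two_iff_integrable_sq_norm hωc.aestronglyMeasurable).2 hω2
    exact lintegral_rpow_enorm_lt_top_of_eLpNorm_lt_top two_ne_zero ENNReal.ofNat_ne_top hm.2 |>
      fun h => by simpa using h

end Main

/-! ### Every Tao-class slice is the Biot–Savart velocity of its vorticity -/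

section Tao

variable {T ν : ℝ} {u₀ : EuclideanSpace ℝ (Fin 3) → EuclideanSpace ℝ (Fin 3)}
  {u : ℝ → EuclideanSpace ℝ (Fin 3) → EuclideanSpace ℝ (Fin 3)}
  {p : ℝ → EuclideanSpace ℝ (Fin 3) → ℝ}

/-- **Every slice of a Tao-class solution is the Biot–Savart velocity of its vorticity**:
`biotSavart (curl (u t)) = u t` for `t ∈ [0, T]`, with NO integrability hypothesis on the vorticity
(compare `IsTaoSolutionOn.biotSavart_curl_eq`, which asks `Integrable (curl (u t))`). The slice is
`C^∞` and divergence free, `∫‖u(t)‖² < ∞` (`integrable_norm_sq`) and `∫‖curl u(t)‖² < ∞`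
(`‖curl w‖ ≤ ‖curlCLM‖‖Dw‖`, `integrable_norm_fderiv_sq`), so
`biotSavart_curl_eq_self_of_integrable_sq` applies. This identifies Gallay–Šverák's "velocity field
`u` … reconstructed from `ω_θ` by the axisymmetric Biot–Savart law" ((1.3), (2.8)) with the velocity
of the tree's smooth finite-energy solutions, for every datum of the class (in particular for
swirl-free data with `ω_θ/r ∈ L¹` only, where `ω(t) ∈ L¹(ℝ³)` is not available): the representation
step of (5.12), `‖u(t)‖_∞ ≤ C‖ω_θ(t)‖_{L¹(Ω)}^{1/2}‖ω_θ(t)‖_{L^∞}^{1/2}`, whose kinematic half is the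
tree's `norm_biotSavart_le_sqrt_of_isAxisymmetric_of_norm_le`.
[cite: GallaySverak2016, §1 (1.3) (arXiv p. 3) and §2.2 (2.8) (p. 6), used in (5.12) (p. 17); MajdaBertozziCUP2002, §2.4.1 Prop. 2.16] -/
theorem IsTaoSolutionOn.biotSavart_curl_eq_self (h : IsTaoSolutionOn T ν u₀ u p) {t : ℝ}
    (ht : t ∈ Icc 0 T) : biotSavart (curl (u t)) = u t := by
  have hu : ContDiff ℝ 2 (u t) := (h.classical.contDiff_velocity ht).of_le (by norm_cast)
  have hv2 : Integrable fun y => ‖u t y‖ ^ 2 := h.integrable_norm_sq ht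
  have hD2 : Integrable fun y => ‖fderiv ℝ (u t) y‖ ^ 2 := h.integrable_norm_fderiv_sq ht
  have hωc : Continuous (curl (u t)) := continuous_curl (hu.of_le (by norm_num))
  have hω2 : Integrable fun y => ‖curl (u t) y‖ ^ 2 := by
    refine (hD2.const_mul (‖curlCLM‖ ^ 2)).mono' (hωc.norm.pow 2).aestronglyMeasurable
      (Eventually.of_forall fun y => ?_)
    rw [Real.norm_of_nonneg (sq_nonneg _), ← mul_pow]
    exact pow_le_pow_left₀ (norm_nonneg _) (norm_curl_le (u t) y) 2
  exact biotSavart_curl_eq_self_of_integrable_sq hu (h.classical.divFree t ht) hv2 hω2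

end Tao

end Literature.Analysis.FluidPDE

end
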